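import Mathlib
import HarnessLib
import HarnessLib.Audit
import Summits.FinalStateConjecture.Statement

/-!
Route: KerrBurial

CLOSED (superseded) 2026-08-15T16:12:59Z by planner-rrepair-FinalStateConjecture-KerrBuria-e303588c-g2-0 — reason: superseded:route-FinalStateConjecture-SwallowTheDatum — superseded by route-FinalStateConjecture-SwallowTheDatum — note: route-repair (cone, gen 2) by planner-rrepair-FinalStateConjecture-KerrBuria-e303588c-g2-0. CONE FINDING: the trigger is stale — payload listed 0 named facts (total "3", cone view file missing); the gate's live audit says staffable YES, 0 unproved deps of 147 consts (deps checked 15:15:30Z; in-file . The file is kept as the record of this route; refuted decls are indexed as negative knowledge (`ledger negatives`).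

# Route KerrBurial — bury the datum inside a giant exact Kerr hole — curve-genericity escaped at
infinity, the typed summit by Kerr bookkeeping (statement-strength audit by proof, N = 1
anti-vacuity)

X = BF ∧ BDS ("it suffices to show"). The typed quantifier `IsChristodoulouGeneric 𝓓 P 1` carries no
topology: a one-parameter family
need only be jointly smooth in (c, x), so F c may differ from F 0 by modifications receding to
infinity as c → 0. BF (BURIAL FAMILIES):
through EVERY admissible datum d passes an admissible, jointly smooth, injective one-parameter
family whose members for c ≠ 0 are
KERR-BURIED — in every MGHD, everything to the future of the data that can signal into the
asymptotic region is an isometric copy Φ(U)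
of an open future set U of the exact sub-extremal Kerr–Schild chart {r > r₀}, r₋ < r₀ < r₊ (a collar
below the horizon included),
containing a whole late Kerr–Schild region, entered by the data hypersurface with radius → ∞,
bounded tilt and below a logarithmic time
profile (parametric interior gluing: ε-rescale d, Hintz-glue it into the KID-free pocket of a Li–Mei
collapsing datum whose exterior is
exactly Kerr, rescale by ε⁻², reparametrise ε = e^{−1/c²}). BDS (BURIED DATA SETTLE, pointwise): a
Kerr-buried admissible datum
satisfies both typed conclusions in every MGHD — sojourn-complete 𝓘⁺ and an exhaustive N = 1
sub-extremal decomposition — by exact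
Kerr causal geometry alone. With Choquet-Bruhat–Geroch (support, shared with SettleThenCensor) the
summit follows by unfolding
`HasCodimAtLeastIn`. Cards realised: swallow-the-datum-genericity-escape (spine), excise-the-unknown
(its N = 1 anti-vacuity leg is BDS).
Diagnostic route: success = `verdict: misstated` on the genericity quantifier (audit slack S2), not
a proof of the conjecture.
Lean: `(∀ (X : Type) [TopologicalSpace X] [ChartedSpace Literature.Geometry.Lorentzian.E3 X]
[IsManifold (modelWithCornersSelf ℝ (EuclideanSpace ℝ (Fin 3))) ((⊤ : ℕ∞) : WithTop ℕ∞) X] [T2Space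
X] [SecondCountableTopology X] [ConnectedSpace X] (D : Literature.Geometry.Lorentzian.InitialDataSet
(modelWithCornersSelf ℝ (EuclideanSpace ℝ (Fin 3))) X), D ∈
Literature.Geometry.Lorentzian.admissibleVacuumData X → ∃ F : EuclideanSpace ℝ (Fin 1) →
Literature.Geometry.Lorentzian.InitialDataSet (modelWithCornersSelf ℝ (EuclideanSpace ℝ (Fin 3))) X,
Literature.Geometry.Lorentzian.InitialDataSet.IsSmoothDataFamily 1 F ∧ F 0 = D ∧ Function.Injective
F ∧ (∀ c, F c ∈ Literature.Geometry.Lorentzian.admissibleVacuumData X) ∧ ∀ c ≠ 0, (∀ 𝒟 :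
Literature.Geometry.Lorentzian.VacuumCauchyDevelopment (F c), 𝒟.IsMaximal → ∃ (M a r₀ C : ℝ) (U :
TopologicalSpace.Opens (EuclideanSpace ℝ (Fin 4))) (Φ : U → 𝒟.carrier) (K : Set X),
Literature.Geometry.Lorentzian.Kerr.IsSubextremal M a ∧ Literature.Geometry.Lorentzian.Kerr.rMinus M
a < r₀ ∧ r₀ < Literature.Geometry.Lorentzian.Kerr.rPlus M a ∧ (U : Set (EuclideanSpace ℝ (Fin 4))) ⊆
(Literature.Geometry.Lorentzian.Kerr.region a r₀ : Set (EuclideanSpace ℝ (Fin 4))) ∧ (∃ τ : ℝ, {x :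
EuclideanSpace ℝ (Fin 4) | x ∈ Literature.Geometry.Lorentzian.Kerr.region a r₀ ∧ τ < x 0} ⊆ (U : Set
(EuclideanSpace ℝ (Fin 4)))) ∧ (∀ (γ : ℝ → EuclideanSpace ℝ (Fin 4)) (t₀ t₁ : ℝ), t₀ ≤ t₁ → (∀ t ∈
Set.Icc t₀ t₁, γ t ∈ Literature.Geometry.Lorentzian.Kerr.region a r₀ ∧ DifferentiableAt ℝ γ t ∧
Literature.Geometry.Lorentzian.Kerr.bilin M a (γ t) (deriv γ t) (deriv γ t) ≤ 0 ∧ deriv γ t ≠ 0 ∧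
Literature.Geometry.Lorentzian.Kerr.bilin M a (γ t) (Literature.Geometry.Lorentzian.Kerr.timeVector
M a (γ t)) (deriv γ t) < 0) → γ t₀ ∈ (U : Set (EuclideanSpace ℝ (Fin 4))) → γ t₁ ∈ (U : Set
(EuclideanSpace ℝ (Fin 4)))) ∧ ContMDiff (modelWithCornersSelf ℝ (EuclideanSpace ℝ (Fin 4)))
(modelWithCornersSelf ℝ (EuclideanSpace ℝ (Fin 4))) ((⊤ : ℕ∞) : WithTop ℕ∞) Φ ∧
Topology.IsOpenEmbedding Φ ∧ (∀ y : U, Literature.Geometry.Lorentzian.pullbackBilin (I := 𝓡 4) (I'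
:= (modelWithCornersSelf ℝ (EuclideanSpace ℝ (Fin 4)))) Φ 𝒟.metric.val y =
Literature.Geometry.Lorentzian.Kerr.bilin M a (y : EuclideanSpace ℝ (Fin 4))) ∧ (∀ y : U,
𝒟.timeOrientation.IsFutureDirected (mfderiv (modelWithCornersSelf ℝ (EuclideanSpace ℝ (Fin 4)))
(modelWithCornersSelf ℝ (EuclideanSpace ℝ (Fin 4))) Φ y
(Literature.Geometry.Lorentzian.Kerr.timeVector M a (y : EuclideanSpace ℝ (Fin 4))))) ∧ IsCompact K
∧ 𝒟.embed '' Kᶜ ⊆ Set.range Φ ∧ (∀ R : ℝ, ∃ K' : Set X, IsCompact K' ∧ ∀ p ∉ K', ∀ y : U, Φ y =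
𝒟.embed p → R < Literature.Geometry.Lorentzian.Kerr.radius a (y : EuclideanSpace ℝ (Fin 4))) ∧ (∀ p
∉ K, ∀ (y : U) (v : EuclideanSpace ℝ (Fin 4)), Φ y = 𝒟.embed p → mfderiv (modelWithCornersSelf ℝ
(EuclideanSpace ℝ (Fin 4))) (modelWithCornersSelf ℝ (EuclideanSpace ℝ (Fin 4))) Φ y v = 𝒟.normal p →
-C ≤ Literature.Geometry.Lorentzian.Kerr.bilin M a (y : EuclideanSpace ℝ (Fin 4))
(Literature.Geometry.Lorentzian.Kerr.timeVector M a (y : EuclideanSpace ℝ (Fin 4))) v) ∧ (∃ τ₁ : ℝ,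
∀ y : U, τ₁ + 4 * M * Real.log (1 + Literature.Geometry.Lorentzian.Kerr.radius a (y : EuclideanSpace
ℝ (Fin 4))) < (y : EuclideanSpace ℝ (Fin 4)) 0 → Φ y ∈ 𝒟.metric.causalFuture 𝒟.timeOrientation
(Set.range 𝒟.embed)) ∧ 𝒟.metric.chronologicalPast 𝒟.timeOrientation (Set.range Φ) ∩
𝒟.metric.causalFuture 𝒟.timeOrientation (Set.range 𝒟.embed) ⊆ Set.range Φ)) ∧ (∀ (X : Type)
[TopologicalSpace X] [ChartedSpace Literature.Geometry.Lorentzian.E3 X] [IsManifold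
(modelWithCornersSelf ℝ (EuclideanSpace ℝ (Fin 3))) ((⊤ : ℕ∞) : WithTop ℕ∞) X] [T2Space X]
[SecondCountableTopology X] [ConnectedSpace X] (D : Literature.Geometry.Lorentzian.InitialDataSet
(modelWithCornersSelf ℝ (EuclideanSpace ℝ (Fin 3))) X), D ∈
Literature.Geometry.Lorentzian.admissibleVacuumData X → (∀ 𝒟 :
Literature.Geometry.Lorentzian.VacuumCauchyDevelopment D, 𝒟.IsMaximal → ∃ (M a r₀ C : ℝ) (U :
TopologicalSpace.Opens (EuclideanSpace ℝ (Fin 4))) (Φ : U → 𝒟.carrier) (K : Set X),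
Literature.Geometry.Lorentzian.Kerr.IsSubextremal M a ∧ Literature.Geometry.Lorentzian.Kerr.rMinus M
a < r₀ ∧ r₀ < Literature.Geometry.Lorentzian.Kerr.rPlus M a ∧ (U : Set (EuclideanSpace ℝ (Fin 4))) ⊆
(Literature.Geometry.Lorentzian.Kerr.region a r₀ : Set (EuclideanSpace ℝ (Fin 4))) ∧ (∃ τ : ℝ, {x :
EuclideanSpace ℝ (Fin 4) | x ∈ Literature.Geometry.Lorentzian.Kerr.region a r₀ ∧ τ < x 0} ⊆ (U : Set
(EuclideanSpace ℝ (Fin 4)))) ∧ (∀ (γ : ℝ → EuclideanSpace ℝ (Fin 4)) (t₀ t₁ : ℝ), t₀ ≤ t₁ → (∀ t ∈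
Set.Icc t₀ t₁, γ t ∈ Literature.Geometry.Lorentzian.Kerr.region a r₀ ∧ DifferentiableAt ℝ γ t ∧
Literature.Geometry.Lorentzian.Kerr.bilin M a (γ t) (deriv γ t) (deriv γ t) ≤ 0 ∧ deriv γ t ≠ 0 ∧
Literature.Geometry.Lorentzian.Kerr.bilin M a (γ t) (Literature.Geometry.Lorentzian.Kerr.timeVector
M a (γ t)) (deriv γ t) < 0) → γ t₀ ∈ (U : Set (EuclideanSpace ℝ (Fin 4))) → γ t₁ ∈ (U : Set
(EuclideanSpace ℝ (Fin 4)))) ∧ ContMDiff (modelWithCornersSelf ℝ (EuclideanSpace ℝ (Fin 4)))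
(modelWithCornersSelf ℝ (EuclideanSpace ℝ (Fin 4))) ((⊤ : ℕ∞) : WithTop ℕ∞) Φ ∧
Topology.IsOpenEmbedding Φ ∧ (∀ y : U, Literature.Geometry.Lorentzian.pullbackBilin (I := 𝓡 4) (I'
:= (modelWithCornersSelf ℝ (EuclideanSpace ℝ (Fin 4)))) Φ 𝒟.metric.val y =
Literature.Geometry.Lorentzian.Kerr.bilin M a (y : EuclideanSpace ℝ (Fin 4))) ∧ (∀ y : U,
𝒟.timeOrientation.IsFutureDirected (mfderiv (modelWithCornersSelf ℝ (EuclideanSpace ℝ (Fin 4)))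
(modelWithCornersSelf ℝ (EuclideanSpace ℝ (Fin 4))) Φ y
(Literature.Geometry.Lorentzian.Kerr.timeVector M a (y : EuclideanSpace ℝ (Fin 4))))) ∧ IsCompact K
∧ 𝒟.embed '' Kᶜ ⊆ Set.range Φ ∧ (∀ R : ℝ, ∃ K' : Set X, IsCompact K' ∧ ∀ p ∉ K', ∀ y : U, Φ y =
𝒟.embed p → R < Literature.Geometry.Lorentzian.Kerr.radius a (y : EuclideanSpace ℝ (Fin 4))) ∧ (∀ p
∉ K, ∀ (y : U) (v : EuclideanSpace ℝ (Fin 4)), Φ y = 𝒟.embed p → mfderiv (modelWithCornersSelf ℝ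
(EuclideanSpace ℝ (Fin 4))) (modelWithCornersSelf ℝ (EuclideanSpace ℝ (Fin 4))) Φ y v = 𝒟.normal p →
-C ≤ Literature.Geometry.Lorentzian.Kerr.bilin M a (y : EuclideanSpace ℝ (Fin 4))
(Literature.Geometry.Lorentzian.Kerr.timeVector M a (y : EuclideanSpace ℝ (Fin 4))) v) ∧ (∃ τ₁ : ℝ,
∀ y : U, τ₁ + 4 * M * Real.log (1 + Literature.Geometry.Lorentzian.Kerr.radius a (y : EuclideanSpace
ℝ (Fin 4))) < (y : EuclideanSpace ℝ (Fin 4)) 0 → Φ y ∈ 𝒟.metric.causalFuture 𝒟.timeOrientation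
(Set.range 𝒟.embed)) ∧ 𝒟.metric.chronologicalPast 𝒟.timeOrientation (Set.range Φ) ∩
𝒟.metric.causalFuture 𝒟.timeOrientation (Set.range 𝒟.embed) ⊆ Set.range Φ) → ∀ 𝒟 :
Literature.Geometry.Lorentzian.VacuumCauchyDevelopment D, 𝒟.IsMaximal →
Summit.FinalStateConjecture.HasCompleteNullInfinity 𝒟.toCauchyDevelopment ∧ ∃ (O : Set 𝒟.carrier) (d
: Literature.Geometry.Lorentzian.FinalStateDecomposition 𝒟.toSpacetime O 2), (∀ i,
Literature.Geometry.Lorentzian.Kerr.IsSubextremal (d.mass i) (d.spin i)) ∧ O =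
Summit.FinalStateConjecture.exteriorOf 𝒟.toCauchyDevelopment d.charted ∧
Summit.FinalStateConjecture.HasExhaustiveCharts d)`

## Assembly
Pure logic (sorry-free in Sketch2.lean, theorem `closes`, axioms propext/choice/Quot.sound): fix X
and an exceptional datum d of the
summit property P (so d ∈ 𝓓); BurialFamilies gives the admissible smooth injective curve F through
d; for c ≠ 0, F c is admissible and
Kerr-buried, so MGHDExistence gives its MGHD and BuriedDataSettle gives both conclusions in every
MGHD, i.e. P (F c): the curve meets the
exceptional set only at c = 0. This is `HasCodimAtLeastIn` unfolded; d itself is never analysed.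

Rationale: WHY THIS LINE. The audit (brief §3, slack S2) kept Christodoulou's topology-free codimension as
source-faithful and argued it is "not trivialising,
because far-away modifications cannot repair a local failure (domain of dependence)"; the card
swallow-the-datum-genericity-escape
(arXiv:2005.01249 Li–Mei, arXiv:2210.13960 Hintz) observes that domain of dependence cuts the other
way: the typed conclusion only
inspects J⁺(ιX) ∩ I⁻(asymptotic charts), so a datum buried inside a giant exact Kerr black hole is
invisible to it, and burial recedes to
infinity along c → 0. This route turns that observation into two typed obligations whose conjunction
literally decides the typed
summit: BF is a theorem-shaped gluing problem (interior Corvino–Schoen/Li–Mei gluing + parametric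
small-data gluing,
doi:10.1017/cbo9781139583961 p. 438 for the landscape, arXiv:2308.13031 as an obstruction-free
engine), BDS is exact-Kerr bookkeeping
in Lean (arXiv:0811.0354 §5.1 Kerr–Schild causal geometry) and doubles as the N = 1 anti-vacuity
theorem of the typed statement
(Li–Mei data satisfy P). Imported: initial-data gluing theory and domain-of-dependence locality
(ChoquetBruhatGeroch1969CMP,
Sbierski2016AHP) — no Einstein dynamics at all, which is the diagnostic point. It differs from
SettleThenCensor (dynamics carries the
genericity) by attacking the quantifier itself; either outcome is informative: BF ∧ BDS ⇒ the
statement must be repaired (families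
continuous at infinity / ADM mass continuous in c); ¬BDS ⇒ a named clause of P is exterior-honest
enough to see burial.

RANKED CRUXES. #2 BurialFamilies (crux) — for every admissible datum D on any connected one-ended X
there is F : ℝ¹ → InitialDataSet with IsSmoothDataFamily 1 F, F 0 = D, F injective, every F c
admissible, and for c ≠ 0 the datum F c Kerr-buried: for every MGHD 𝒟 there are sub-extremal (M, a),
a collar radius r₋ < r₀ < r₊, a tilt constant C, an open U ⊆ {r > r₀} of Kerr–Schild E⁴ containing a
late region {t* > τ} and closed under future-directed causal curves of g_{M,a}, a smooth open
embedding Φ : U → 𝒟 with Φ^*g = g_{M,a} and dΦ(−g♯dt*) future-directed, a compact K ⊆ X with ι(X ∖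
K) ⊆ Φ(U), Kerr–Schild radius of ι(p) → ∞ as p → ∞, |g_{M,a}(V, dΦ⁻¹ν)| ≤ C on ι(X ∖ K), points of U
above t* = τ₁ + 4M log(1 + r) mapped into J⁺(ιX), and I⁻(Φ U) ∩ J⁺(ιX) ⊆ Φ(U) (card
swallow-the-datum N1–N3 + the locality half of N4). [difficulty: XL] (why it might fail: Needs
below-horizon gluing with a KID-free pocket, PARAMETRIC gluing of an ε-rescaled arbitrary complete
one-ended datum (Hintz Thm 1.2 is for ℝⁿ∖K̂° backgrounds), flat reparametrisation to joint C^∞ at c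
= 0 on the fixed X, exact DR fall-off, injectivity in c, locality for every MGHD.)
[arXiv:2005.01249, arXiv:2210.13960, arXiv:2308.13031, doi:10.1017/cbo9781139583961,
ChoquetBruhatGeroch1969CMP, Sbierski2016AHP, Christodoulou1999]
#3 BuriedDataSettle (crux) — for every admissible datum (no genericity) which is Kerr-buried in the
above sense, every MGHD has complete future null infinity in the sojourn form AND carries a region O
and a C² final-state decomposition with N = 1, sub-extremal (M, a), O = J⁺(ιX) ∩ I⁻(d.charted) and
HasExhaustiveCharts — by exact Kerr–Schild causal geometry: time-shifted identity charts above the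
logarithmic data profile (deviation c′(τ) → 0), ZAMO/principal-null curves for exhaustiveness,
horizon monotonicity of r in the collar, affine-parameter bookkeeping of far rays with the tilt
constant (card swallow-the-datum N4; excise-the-unknown P3: the N = 1 anti-vacuity of the typed
summit). [difficulty: L] (why it might fail: Chart images must lie in J⁺(ιX) above a logarithmically
rising data slice, forcing time-shifted Kerr–Schild charts (deviation → 0, not 0); exhaustiveness
across shifted zones, the collar below r₊ and ingoing-ray sojourn are genuine Kerr causal geometry;
a clause of P may yet see the burial.) [arXiv:0811.0354, ONeill1995, DafermosLuk2017,
Christodoulou1999, arXiv:2005.01249]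
#9 MGHDExistence (support) — Choquet-Bruhat–Geroch with Sbierski's dezornification, over the
repaired structure: every admissible datum has a vacuum Cauchy development which is maximal
(`VacuumCauchyDevelopment.IsMaximal`). Shared verbatim with route SettleThenCensor
(stmt-FinalStateConjecture-10009). [difficulty: XL] [ChoquetBruhatGeroch1969CMP, Sbierski2016AHP,
Ringstrom2009]

TWO-LAYER PLAN. BF ⇐ BurialBackground → ParametricPocketGluing → BF (k = 2): BurialBackground = "for
every sub-extremal (M, a) (a = 0 suffices) there
is a complete one-ended admissible datum on ℝ³ whose MGHDs are Kerr-buried with a KID-free open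
pocket inside the compact part"
(Li–Mei + Beig–Chruściel–Schoen); ParametricPocketGluing = "any complete one-ended admissible (X, d)
ε-rescaled glues into a KID-free
pocket of any admissible background, exactly outside the pocket, jointly smooth in (c, x) on the
fixed X after ε = e^{−1/c²}, injective
in c" (Hintz / Mao–Oh–Tao engine). BDS ⇐ KerrCausalBookkeeping (O, exhaustiveness, charts) →
KerrSojourn (complete 𝓘⁺) → BDS (k = 2).

KILL CRITERIA. ¬BuriedDataSettle by a named clause of P that sees inside the hole (sojourn rays
forced through the pocket, or exhaustiveness failing for
time-shifted charts in EXACT Kerr) closes the route `refuted:BuriedDataSettle` and settles audit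
slack S2 positively (the typing is
burial-proof) — valuable either way. ¬BurialFamilies for some admissible datum (an obstruction to
parametric interior gluing on some X, or
DR fall-off incompatible with every bent Kerr slice) closes it `refuted:BurialFamilies`. A statement
repair of the genericity quantifier
(families continuous into a weighted C²₋₁ × C¹₋₂ topology, ADM mass continuous in c — the card's
recommendation) retires the route by
design: that is the intended diagnostic outcome and should be requested the moment BF's layer-2
children look provable. If BF ∧ BDS are
proved the seat reports `verdict: misstated` (typed summit closed without dynamics), never "FSC
proved".

NOT DECOMPOSED YET. The two-layer children above; the a = 0 (Schwarzschild) special case of BDS as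
the first Lean target; the exact reference slice
(Boyer–Lindquist far out, Kerr–Schild through the horizon) and its DR fall-off in X's own isotropic
chart; the Kerr geodesic facts BDS
consumes (null geodesics of {r > r₀} are complete or reach r₀; r is a time function in the collar;
t* is a time function) — prover-level
`--supports` lemmas over KerrSchild/KerrHorizonCausality/KerrDomainOfDependence, not items.

CHEAPEST FALSIFIER. Exact Schwarzschild, identity burial (Φ = id, pocket empty): does the
Kerr–Schild region {r > r₀}, r₀ ∈ (0, 2M), with a data slice
t* = 2M log(1 + r) far out, satisfy every clause of the burial predicate AND can BDS's charts be
written down (time shift c(τ) ≍ 4M log R(τ),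
c′ → 0; near zone R(τ) = √τ, tube ρ(τ) = √τ − 1)? This is a paper computation a refuter can do in an
hour and a Lean target over the
prelude; I checked on paper that exhaustiveness and the J⁺(ιX) placement are consistent for these
choices (NOTES.md), the sojourn bound
for ingoing rays being ≥ (r_p − R₀)/2 − C. Second: `lean check` that `IsSmoothDataFamily` accepts a
family equal to F 0 on B_{1/|c|} and
to another admissible datum outside B_{2/|c|} (joint smoothness at c = 0 is then automatic) — the
formal core of the escape.

NUMBERS. Burial background: Li–Mei (arXiv:2005.01249, Main Theorem): one-ended data on ℝ³, complete
𝓘⁺, isometric to Kerr(m, a), |a| ≪ m,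
outside D⁺(Ω); Hintz (arXiv:2210.13960, Thm 1.1/1.2): ε-families of glued data, polyhomogeneous in
ε, exact outside the gluing
neighbourhood; Kerr–Schild slice data are NOT DR-admissible for M ≠ 0 (prelude
`Kerr.not_isStronglyAsymptoticallyFlatDR_data`: tr k ~ 2M/r²),
hence the bent reference slice and the logarithmic profile 4M log(1 + r) ≥ r*(r) − r + O(1) in the
predicate. Items at open: 4.

DEFINITION REQUESTS. None blocking (the burial predicate is inlined over
KerrSchild/CauchyDevelopment/Causality). Wanted later, for the layer-2 split of BF:
`IsKIDFree (D : InitialDataSet) (U : Opens X)` (no Killing initial data on U; Beig–Chruściel–Schoen)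
and a named fact for Li–Mei's
Main Theorem over `VacuumCauchyDevelopment` — to be filed by the tenure planner when BF is split.

Novelty: Searches (2026-08-15): `lit vsearch "gluing construction of vacuum initial data with exactly Kerr or
Schwarzschild exterior …; generic
initial data by gluing" -k 10 --no-graph` (10 held books; nearest: Isenberg in
Ashtekar–Berger–Isenberg–MacCallum 2015,
doi:10.1017/cbo9781139583961 p. 438 — Corvino–Schoen/Carlotto–Schoen exterior gluing, "evolutions of
such N-body data have not been
studied"; Valiente Kroon 2016 p. 305; Rendall 2008 p. 208); `lit vsearch "completeness of future
null infinity follows from the exterior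
settling …" --no-graph` (KS AMS-210 pp. 89–90); `lit galaxy search "final state conjecture" --star
pdf` (3 hits, irrelevant);
`lit frontier` / `lit bridges FinalStateConjecture` (arXiv:2601.01517 multi-black-hole Cauchy data
by gluing — a burial-adjacent
engine; nothing uses gluing against a genericity clause); searchd (`lit search`) unavailable this
session (rc 75); the card's own
searches (Li–Mei §2.2 p. 8, Hintz Thm 1.1/1.2/5.2/6.2 read at page level by its author and the
grader).
Nearest prior art found: arXiv:2005.01249 (Li–Mei: collapse data exactly Kerr outside D⁺(Ω), the
background), arXiv:2210.13960 (Hintz: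
parametric gluing of rescaled data, the engine), doi:10.1017/cbo9781139583961 p. 438 (gluing
landscape), card
swallow-the-datum-genericity-escape (graded new-combination: "nothing in print uses gluing to
SATISFY a genericity clause").
Delta: the card's exploit made into a typed, decidable route — an explicit burial predicate over the
prelude whose tw  [refs: 10.1017/cbo9781139583961, 2601.01517, 2005.01249, 2210.13960, doi:10.1017/cbo9781139583961]

Barriers (technique_class: statement-audit, initial-data-gluing, domain-of-dependence): - technique_class: statement-audit, initial-data-gluing, domain-of-dependence
- Literature.Barriers.FinalStateConjecture.nakedSingularityInstability: evaded by construction — no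
genericity-blind claim and no claim about d at all; the line lives inside the ∃-family clause,
exactly where Christodoulou's instability theorem also lives, but with burial instead of dynamics.
- Literature.Barriers.FinalStateConjecture.AretakisInstability: not met — the burial background is
exactly sub-extremal (a = 0 allowed), no horizon dynamics.
- Literature.Barriers.FinalStateConjecture.SlowlyRotatingKerrFrontier: not met — no stability
theorem is invoked; the exterior is EXACT Kerr (deviation of the time-shifted charts is pure gauge
c′(τ) → 0).
- Literature.Barriers.FinalStateConjecture.KerrSuperradiance: not met — no energy estimate; the
ergoregion enters BDS only through causal curves (ZAMO directions), which exist for every |a| < M.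
- Literature.Barriers.FinalStateConjecture.SbierskiTrappingObstruction: not met — no decay estimate.
- Literature.Barriers.FinalStateConjecture.PriceLawTail: not met — no rates; exact Kerr.
- Literature.Barriers.FinalStateConjecture.KehrbergerLogarithmicAsymptotics: not met — sojourn
completeness inside exact Kerr, no conformal compactification (the log profile in the predicate is
the tortoise shift of the data slice, not a 𝓘⁺ expansion).
- Literature.Barriers.FinalStateConjecture.IonescuKlainermanNonExtension: not met — no rigidity
step; Kerr-ness is built in, no

Novelty grade: variant — ROUTE REVIEW (refuter rreview-0815T15-8-0): DUPLICATE OF THE OPEN ROUTE SwallowTheDatum — recommend the reconciler/tenure planner CLOSE KerrBurial as duplicate-of route-FinalStateConjecture-SwallowTheDatum or MERGE it in. Same card (swallow-the-datum-genericity-escape), same mechanism (topology-free (refuter refuter-rreview-0815T15-8-0, 2026-08-15T15:52:36Z; prior: route-FinalStateConjecture-SwallowTheDatum, idea:FinalStateConjecture/FinalStateConjecture/swallow-the-datum-genericity-escape, arXiv:2005.01249, arXiv:2210.13960, arXiv:2308.13031)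

History (route lifecycle, newest last):
- 2026-08-15T16:13:00Z · CLOSED superseded — superseded:route-FinalStateConjecture-SwallowTheDatum (planner-rrepair-FinalStateConjecture-KerrBuria-e303588c-g2-0)

sub-problem: FinalStateConjecture · status: closed(superseded) · opened planner-plan-FinalStateConjecture-0 2026-08-15T15:14:20Z · rev 1 · ledger route-FinalStateConjecture-KerrBurial
GENERATED by the gate from the ledger (D-0016/17). Provers cite these decls: `theorem foo : Summit.FinalStateConjecture.FinalStateConjecture.Theses.KerrBurial.<Decl> := …` in Summits/FinalStateConjecture/FinalStateConjecture/Theorems/<Name>.lean.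
-/

namespace Summit.FinalStateConjecture.FinalStateConjecture.Theses.KerrBurial

open scoped BigOperators Topology Manifold Classical MeasureTheory ProbabilityTheory Matrix InnerProductSpace ComplexConjugate ContinuousMap
open Filter Set Function TopologicalSpace MeasureTheory

attribute [summit_statement] _root_.FinalStateConjecture

/-- item stmt-FinalStateConjecture-10150 · crux · rank 2 · closed · moot by None · by planner
why it might fail: No engine fits: Hintz 2210.13960 Thm 1.2 needs the inserted datum δ-AF polyhomogeneous on ℝ³∖K̂° (DR data: o₂/o₁, any X); Thm 6.2 enters Kerr only by violating constraints in the hole; KID-free pocket in the Li–Mei hole unproved; flat-in-c smoothness needs (ε∂ε)-regular gluing; MGHD locality.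
sources: Hintz2022, LiMei2020, MaoOhTao2023, BeigChruscielSchoen2004, ChruscielDelay2003, CorvinoSchoen2006
[crux] for every admissible datum D on any connected one-ended X there is F : ℝ¹ → InitialDataSet
with IsSmoothDataFamily 1 F, F 0 = D, F injective, every F c admissible, and for c ≠ 0 the datum F c
Kerr-buried: for every MGHD 𝒟 there are sub-extremal (M, a), a collar radius r₋ < r₀ < r₊, a tilt
constant C, an open U ⊆ {r > r₀} of Kerr–Schild E⁴ containing a late region {t* > τ} and closed
under future-directed causal curves of g_{M,a}, a smooth open embedding Φ : U → 𝒟 with Φ^*g =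
g_{M,a} and dΦ(−g♯dt*) future-directed, a compact K ⊆ X with ι(X ∖ K) ⊆ Φ(U), Kerr–Schild radius of
ι(p) → ∞ as p → ∞, |g_{M,a}(V, dΦ⁻¹ν)| ≤ C on ι(X ∖ K), points of U above t* = τ₁ + 4M log(1 + r)
mapped into J⁺(ιX), and I⁻(Φ U) ∩ J⁺(ιX) ⊆ Φ(U) (card swallow-the-datum N1–N3 + the locality half of
N4). [difficulty: XL] -/
@[route_item "route-FinalStateConjecture-KerrBurial"]
def BurialFamilies : Prop :=
  ∀ (X : Type) [TopologicalSpace X] [ChartedSpace Literature.Geometry.Lorentzian.E3 X] [IsManifold (modelWithCornersSelf ℝ (EuclideanSpace ℝ (Fin 3))) ((⊤ : ℕ∞) : WithTop ℕ∞) X] [T2Space X] [SecondCountableTopology X] [ConnectedSpace X] (D : Literature.Geometry.Lorentzian.InitialDataSet (modelWithCornersSelf ℝ (EuclideanSpace ℝ (Fin 3))) X), D ∈ Literature.Geometry.Lorentzian.admissibleVacuumData X → ∃ F : EuclideanSpace ℝ (Fin 1) → Literature.Geometry.Lorentzian.InitialDataSet (modelWithCornersSelf ℝ (EuclideanSpace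 ℝ (Fin 3))) X, Literature.Geometry.Lorentzian.InitialDataSet.IsSmoothDataFamily 1 F ∧ F 0 = D ∧ Function.Injective F ∧ (∀ c, F c ∈ Literature.Geometry.Lorentzian.admissibleVacuumData X) ∧ ∀ c ≠ 0, (∀ 𝒟 : Literature.Geometry.Lorentzian.VacuumCauchyDevelopment (F c), 𝒟.IsMaximal → ∃ (M a r₀ C : ℝ) (U : TopologicalSpace.Opens (EuclideanSpace ℝ (Fin 4))) (Φ : U → 𝒟.carrier) (K : Set X), Literature.Geometry.Lorentzian.Kerr.IsSubextremal M a ∧ Literature.Geometry.Lorentzian.Kerr.rMinus M a < r₀ ∧ r₀ < Literature.Geometry.Lorentzian.Kerr.rPlus M a ∧ (U : Set (EuclideanSpace ℝ (Fin 4))) ⊆ (Literature.Geometry.Lorentzian.Kerr.region a r₀ : Set (EuclideanSpace ℝ (Fin 4))) ∧ (∃ τ : ℝ, {x : EuclideanSpace ℝ (Fin 4) | x ∈ Literature.Geometry.Lorentzian.Kerr.region a r₀ ∧ τ < x 0} ⊆ (U : Set (EuclideanSpace ℝ (Fin 4)))) ∧ (∀ (γ : ℝ → EuclideanSpace ℝ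 (Fin 4)) (t₀ t₁ : ℝ), t₀ ≤ t₁ → (∀ t ∈ Set.Icc t₀ t₁, γ t ∈ Literature.Geometry.Lorentzian.Kerr.region a r₀ ∧ DifferentiableAt ℝ γ t ∧ Literature.Geometry.Lorentzian.Kerr.bilin M a (γ t) (deriv γ t) (deriv γ t) ≤ 0 ∧ deriv γ t ≠ 0 ∧ Literature.Geometry.Lorentzian.Kerr.bilin M a (γ t) (Literature.Geometry.Lorentzian.Kerr.timeVector M a (γ t)) (deriv γ t) < 0) → γ t₀ ∈ (U : Set (EuclideanSpace ℝ (Fin 4))) → γ t₁ ∈ (U : Set (EuclideanSpace ℝ (Fin 4)))) ∧ ContMDiff (modelWithCornersSelf ℝ (EuclideanSpace ℝ (Fin 4))) (modelWithCornersSelf ℝ (EuclideanSpace ℝ (Fin 4))) ((⊤ : ℕ∞) : WithTop ℕ∞) Φ ∧ Topology.IsOpenEmbedding Φ ∧ (∀ y : U, Literature.Geometry.Lorentzian.pullbackBilin (I := 𝓡 4) (I' := (modelWithCornersSelf ℝ (EuclideanSpace ℝ (Fin 4)))) Φ 𝒟.metric.val y = Literature.Geometry.Lorentzian.Kerr.bilin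 M a (y : EuclideanSpace ℝ (Fin 4))) ∧ (∀ y : U, 𝒟.timeOrientation.IsFutureDirected (mfderiv (modelWithCornersSelf ℝ (EuclideanSpace ℝ (Fin 4))) (modelWithCornersSelf ℝ (EuclideanSpace ℝ (Fin 4))) Φ y (Literature.Geometry.Lorentzian.Kerr.timeVector M a (y : EuclideanSpace ℝ (Fin 4))))) ∧ IsCompact K ∧ 𝒟.embed '' Kᶜ ⊆ Set.range Φ ∧ (∀ R : ℝ, ∃ K' : Set X, IsCompact K' ∧ ∀ p ∉ K', ∀ y : U, Φ y = 𝒟.embed p → R < Literature.Geometry.Lorentzian.Kerr.radius a (y : EuclideanSpace ℝ (Fin 4))) ∧ (∀ p ∉ K, ∀ (y : U) (v : EuclideanSpace ℝ (Fin 4)), Φ y = 𝒟.embed p → mfderiv (modelWithCornersSelf ℝ (EuclideanSpace ℝ (Fin 4))) (modelWithCornersSelf ℝ (EuclideanSpace ℝ (Fin 4))) Φ y v = 𝒟.normal p → -C ≤ Literature.Geometry.Lorentzian.Kerr.bilin M a (y : EuclideanSpace ℝ (Fin 4)) (Literature.Geometry.Lorentzian.Kerr.timeVector M a (y : EuclideanSpace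 ℝ (Fin 4))) v) ∧ (∃ τ₁ : ℝ, ∀ y : U, τ₁ + 4 * M * Real.log (1 + Literature.Geometry.Lorentzian.Kerr.radius a (y : EuclideanSpace ℝ (Fin 4))) < (y : EuclideanSpace ℝ (Fin 4)) 0 → Φ y ∈ 𝒟.metric.causalFuture 𝒟.timeOrientation (Set.range 𝒟.embed)) ∧ 𝒟.metric.chronologicalPast 𝒟.timeOrientation (Set.range Φ) ∩ 𝒟.metric.causalFuture 𝒟.timeOrientation (Set.range 𝒟.embed) ⊆ Set.range Φ)

/-- item stmt-FinalStateConjecture-10151 · crux · rank 3 · closed · moot by None · by planner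
why it might fail: May fail as typed: IsLateChart.image_subset puts whole chart images (all r at time τ₀⁺) in O ⊆ J⁺(ιX) above a DR slice rising ~2M log r, forcing bent/shifted charts, deviation → 0 only on receding zones; exhaustiveness ∀τ₁, sub-horizon collar, ingoing-ray sojourn (one-sided tilt bound) unverified.
sources: DafermosRodnianski2008, ONeillKerr1995, DafermosHolzegelRodnianskiTaylor2021, DafermosLuk2017, Christodoulou1999, LiMei2020
[crux] for every admissible datum (no genericity) which is Kerr-buried in the above sense, every
MGHD has complete future null infinity in the sojourn form AND carries a region O and a C²
final-state decomposition with N = 1, sub-extremal (M, a), O = J⁺(ιX) ∩ I⁻(d.charted) and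
HasExhaustiveCharts — by exact Kerr–Schild causal geometry: time-shifted identity charts above the
logarithmic data profile (deviation c′(τ) → 0), ZAMO/principal-null curves for exhaustiveness,
horizon monotonicity of r in the collar, affine-parameter bookkeeping of far rays with the tilt
constant (card swallow-the-datum N4; excise-the-unknown P3: the N = 1 anti-vacuity of the typed
summit). [difficulty: L] -/
@[route_item "route-FinalStateConjecture-KerrBurial"]
def BuriedDataSettle : Prop :=
  ∀ (X : Type) [TopologicalSpace X] [ChartedSpace Literature.Geometry.Lorentzian.E3 X] [IsManifold (modelWithCornersSelf ℝ (EuclideanSpace ℝ (Fin 3))) ((⊤ : ℕ∞) : WithTop ℕ∞) X] [T2Space X] [SecondCountableTopology X] [ConnectedSpace X] (D : Literature.Geometry.Lorentzian.InitialDataSet (modelWithCornersSelf ℝ (EuclideanSpace ℝ (Fin 3))) X), D ∈ Literature.Geometry.Lorentzian.admissibleVacuumData X → (∀ 𝒟 : Literature.Geometry.Lorentzian.VacuumCauchyDevelopment D, 𝒟.IsMaximal → ∃ (M a r₀ C : ℝ) (U : TopologicalSpace.Opens (EuclideanSpace ℝ (Fin 4))) (Φ : U → 𝒟.carrier) (K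 : Set X), Literature.Geometry.Lorentzian.Kerr.IsSubextremal M a ∧ Literature.Geometry.Lorentzian.Kerr.rMinus M a < r₀ ∧ r₀ < Literature.Geometry.Lorentzian.Kerr.rPlus M a ∧ (U : Set (EuclideanSpace ℝ (Fin 4))) ⊆ (Literature.Geometry.Lorentzian.Kerr.region a r₀ : Set (EuclideanSpace ℝ (Fin 4))) ∧ (∃ τ : ℝ, {x : EuclideanSpace ℝ (Fin 4) | x ∈ Literature.Geometry.Lorentzian.Kerr.region a r₀ ∧ τ < x 0} ⊆ (U : Set (EuclideanSpace ℝ (Fin 4)))) ∧ (∀ (γ : ℝ → EuclideanSpace ℝ (Fin 4)) (t₀ t₁ : ℝ), t₀ ≤ t₁ → (∀ t ∈ Set.Icc t₀ t₁, γ t ∈ Literature.Geometry.Lorentzian.Kerr.region a r₀ ∧ DifferentiableAt ℝ γ t ∧ Literature.Geometry.Lorentzian.Kerr.bilin M a (γ t) (deriv γ t) (deriv γ t) ≤ 0 ∧ deriv γ t ≠ 0 ∧ Literature.Geometry.Lorentzian.Kerr.bilin M a (γ t) (Literature.Geometry.Lorentzian.Kerr.timeVector M a (γ t)) (deriv γ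 t) < 0) → γ t₀ ∈ (U : Set (EuclideanSpace ℝ (Fin 4))) → γ t₁ ∈ (U : Set (EuclideanSpace ℝ (Fin 4)))) ∧ ContMDiff (modelWithCornersSelf ℝ (EuclideanSpace ℝ (Fin 4))) (modelWithCornersSelf ℝ (EuclideanSpace ℝ (Fin 4))) ((⊤ : ℕ∞) : WithTop ℕ∞) Φ ∧ Topology.IsOpenEmbedding Φ ∧ (∀ y : U, Literature.Geometry.Lorentzian.pullbackBilin (I := 𝓡 4) (I' := (modelWithCornersSelf ℝ (EuclideanSpace ℝ (Fin 4)))) Φ 𝒟.metric.val y = Literature.Geometry.Lorentzian.Kerr.bilin M a (y : EuclideanSpace ℝ (Fin 4))) ∧ (∀ y : U, 𝒟.timeOrientation.IsFutureDirected (mfderiv (modelWithCornersSelf ℝ (EuclideanSpace ℝ (Fin 4))) (modelWithCornersSelf ℝ (EuclideanSpace ℝ (Fin 4))) Φ y (Literature.Geometry.Lorentzian.Kerr.timeVector M a (y : EuclideanSpace ℝ (Fin 4))))) ∧ IsCompact K ∧ 𝒟.embed '' Kᶜ ⊆ Set.range Φ ∧ (∀ R : ℝ, ∃ K' : Set X,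 IsCompact K' ∧ ∀ p ∉ K', ∀ y : U, Φ y = 𝒟.embed p → R < Literature.Geometry.Lorentzian.Kerr.radius a (y : EuclideanSpace ℝ (Fin 4))) ∧ (∀ p ∉ K, ∀ (y : U) (v : EuclideanSpace ℝ (Fin 4)), Φ y = 𝒟.embed p → mfderiv (modelWithCornersSelf ℝ (EuclideanSpace ℝ (Fin 4))) (modelWithCornersSelf ℝ (EuclideanSpace ℝ (Fin 4))) Φ y v = 𝒟.normal p → -C ≤ Literature.Geometry.Lorentzian.Kerr.bilin M a (y : EuclideanSpace ℝ (Fin 4)) (Literature.Geometry.Lorentzian.Kerr.timeVector M a (y : EuclideanSpace ℝ (Fin 4))) v) ∧ (∃ τ₁ : ℝ, ∀ y : U, τ₁ + 4 * M * Real.log (1 + Literature.Geometry.Lorentzian.Kerr.radius a (y : EuclideanSpace ℝ (Fin 4))) < (y : EuclideanSpace ℝ (Fin 4)) 0 → Φ y ∈ 𝒟.metric.causalFuture 𝒟.timeOrientation (Set.range 𝒟.embed)) ∧ 𝒟.metric.chronologicalPast 𝒟.timeOrientation (Set.range Φ) ∩ 𝒟.metric.causalFuture 𝒟.timeOrientation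 (Set.range 𝒟.embed) ⊆ Set.range Φ) → ∀ 𝒟 : Literature.Geometry.Lorentzian.VacuumCauchyDevelopment D, 𝒟.IsMaximal → Summit.FinalStateConjecture.HasCompleteNullInfinity 𝒟.toCauchyDevelopment ∧ ∃ (O : Set 𝒟.carrier) (d : Literature.Geometry.Lorentzian.FinalStateDecomposition 𝒟.toSpacetime O 2), (∀ i, Literature.Geometry.Lorentzian.Kerr.IsSubextremal (d.mass i) (d.spin i)) ∧ O = Summit.FinalStateConjecture.exteriorOf 𝒟.toCauchyDevelopment d.charted ∧ Summit.FinalStateConjecture.HasExhaustiveCharts d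

/-- item stmt-FinalStateConjecture-10009 · support · rank 9 · open · by planner
sources: ChoquetBruhatGeroch1969CMP, Sbierski2016AHP, Ringstrom2009
[support] Choquet-Bruhat–Geroch with Sbierski's dezornification, over the repaired structure: every
admissible datum has a vacuum Cauchy development which is maximal
(`VacuumCauchyDevelopment.IsMaximal`: every vacuum Cauchy development of the same data embeds into
it). Discharges the anti-vacuity conjunct of the summit; shared verbatim by every route of this
sub-problem. [difficulty: XL] -/
@[route_item "route-FinalStateConjecture-KerrBurial"]
def MGHDExistence : Prop :=
  ∀ (X : Type) [TopologicalSpace X] [ChartedSpace Literature.Geometry.Lorentzian.E3 X] [IsManifold (modelWithCornersSelf ℝ (EuclideanSpace ℝ (Fin 3))) ((⊤ : ℕ∞) : WithTop ℕ∞) X] [T2Space X] [SecondCountableTopology X] [ConnectedSpace X] (D : Literature.Geometry.Lorentzian.InitialDataSet (modelWithCornersSelf ℝ (EuclideanSpace ℝ (Fin 3))) X), D ∈ Literature.Geometry.Lorentzian.admissibleVacuumData X → ∃ 𝒟 : Literature.Geometry.Lorentzian.VacuumCauchyDevelopment D, 𝒟.IsMaximal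

/-- item stmt-FinalStateConjecture-10152 · assembly · rank 1 · closed · moot by None · by planner
sources: Christodoulou1999, arXiv:2005.01249
[assembly] BurialFamilies → BuriedDataSettle → MGHDExistence → FinalStateConjecture. -/
@[route_item "route-FinalStateConjecture-KerrBurial"]
def Assembly : Prop :=
  BurialFamilies → BuriedDataSettle → MGHDExistence → FinalStateConjecture

end Summit.FinalStateConjecture.FinalStateConjecture.Theses.KerrBurial
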